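import Mathlib
import Literature.Probability.MarkovChains.MetropolisHastings
import Literature.Probability.MarkovChains.TotalVariation
import Summits.Ventures.LatticeQCDFlow.Exactness.FlowMCMC
import Summits.Ventures.LatticeQCDFlow.Scaling.ImportanceWeights
import Summits.Ventures.LatticeQCDFlow.Scaling.SectorBudget
import Summits.Ventures.LatticeQCDFlow.Scaling.BlockDefect
import Summits.Ventures.LatticeQCDFlow.Scaling.StochasticBudgets
import Summits.Ventures.LatticeQCDFlow.Scaling.VarianceLaws

/-!
# LatticeQCDFlow / Scaling — acceptance tails (T2-AB) and the sector acceptance cap (L-9)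

HONEST FRAMING: exact (Metropolis-corrected) sampling algorithms for lattice gauge theory;
figures of merit are autocorrelation/cost numbers at stated couplings and volumes; no
continuum-physics claim.

Venture `LatticeQCDFlow` (cell pub-lqcd), topic `Scaling`, THEORY-2.md §3.7 / §4 T2-AB and L-9
(v1.7), prepared for landing by the theory seat (FANOUT row 29) from `HOME/THEORY-2-Sketch.lean`
v1.8, rebased on the tree's `Exactness/FlowMCMC` (`accRate`, `accRate_le`), `Scaling/SectorBudget`
(`coarse`), `Scaling/StochasticBudgets` (`accRate_le_accRate_coarse`) and `Scaling/VarianceLaws`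
(`logW`, `varLaw`, `chebyshev_set`).

* **T2-AB** (acceptance tails; `accRate_le_tails`, `accRate_le_of_jeffreys`): for every
  threshold `c` and margin `a`, `acc(p,q) ≤ e^{−a} + p(ℓ < c) + q(ℓ > c − a)` (`ℓ = log(p/q)`);
  with Chebyshev, `acc ≤ e^{−J/2} + 16(Var_p ℓ + Var_q ℓ)/J²` for any `0 < J ≤ D(p‖q) + D(q‖p)`.
  So a Jeffreys divergence growing linearly in the volume (T2-I: `D(p‖q) ≥ 2mδ²`) with
  log-weight variances growing at most linearly forces the stationary ACCEPTANCE of flow-MCMC to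
  zero — the acceptance-side volume law, which cannot hold without a variance hypothesis
  (THEORY-2.md T2-X, acceptance blindness: `Var_p ℓ ∝ m²` examples keep `acc` bounded below).
* **L-9** (`accRate_le_one_sub_tvDist_coarse`): `acc ≤ 1 − ‖π_*p − π_*q‖_TV` for every
  coarse-graining `π` (topological charge): the sector histogram of the MODEL caps the exact
  sampler's acceptance, whatever the model does inside the sectors.

Elementary (`[folklore]`-level; cf. Le Cam's testing bound); farm `lean check` rc 0, no `sorry`.
-/

namespace Summit.Ventures.LatticeQCDFlow.Theory2

open Finset
open Literature.Probability.MarkovChains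
open Summit.Ventures.LatticeQCDFlow.Exactness

variable {X : Type*} [Fintype X]

omit [Fintype X] in
/-- `b · (a / b) = a` for `b ≠ 0` (module-private copy of the helper of `Scaling/VarianceLaws.lean`,
which is `private` there). [folklore] -/
private theorem mul_div_cancel_pos {a b : ℝ} (hb : b ≠ 0) : b * (a / b) = a := by
  rw [← mul_div_assoc, mul_div_cancel_left₀ a hb]

/-! ### T2-AB: acceptance tails, Chebyshev form, and the acceptance volume law under a variance
budget -/

section AccTails

/-- **T2-AB (acceptance test bound; proved).**  For every threshold `c` and margin `a`:
`acc(p, q) ≤ e^{−a} + p(ℓ < c) + q(ℓ > c − a)`, `ℓ = log(p/q)`.  (Pairs with `ℓ x ≥ c` and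
`ℓ y ≤ c − a` accept with probability `≤ e^{ℓ y − ℓ x} ≤ e^{−a}`.) [folklore; cf. Le Cam's
testing bound] -/
theorem accRate_le_tails {p q : X → ℝ} (hp : ∀ x, 0 < p x) (hq : ∀ x, 0 < q x)
    (hp1 : ∑ x, p x = 1) (hq1 : ∑ x, q x = 1) (a c : ℝ) :
    accRate p q ≤ Real.exp (-a) + ∑ x ∈ univ.filter (fun x => logW p q x < c), p x
      + ∑ y ∈ univ.filter (fun y => c - a < logW p q y), q y := by
  have hw : ∀ x, Real.exp (logW p q x) = p x / q x :=
    fun x => Real.exp_log (div_pos (hp x) (hq x))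
  have hswap : ∀ x y, p y * q x = p x * q y * Real.exp (logW p q y - logW p q x) := by
    intro x y
    rw [sub_eq_add_neg, Real.exp_add, Real.exp_neg, hw, hw, inv_div]
    rw [show p x * q y * (p y / q y * (q x / p x)) = (q y * (p y / q y)) * (p x * (q x / p x))
        by ring, mul_div_cancel_pos (hq y).ne', mul_div_cancel_pos (hp x).ne']
  set iL : X → ℝ := fun x => if logW p q x < c then 1 else 0 with hiL
  set iU : X → ℝ := fun y => if c - a < logW p q y then 1 else 0 with hiU
  have hiL0 : ∀ x, 0 ≤ iL x := fun x => by
    simp only [hiL]; split_ifs <;> norm_num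
  have hiU0 : ∀ y, 0 ≤ iU y := fun y => by
    simp only [hiU]; split_ifs <;> norm_num
  have hpt : ∀ x y, min (p x * q y) (p y * q x) ≤
      Real.exp (-a) * (p x * q y) + iL x * (p x * q y) + iU y * (p x * q y) := by
    intro x y
    have h0 : 0 ≤ p x * q y := mul_nonneg (hp x).le (hq y).le
    have hE : 0 ≤ Real.exp (-a) * (p x * q y) := mul_nonneg (Real.exp_pos _).le h0
    have hL0 : 0 ≤ iL x * (p x * q y) := mul_nonneg (hiL0 x) h0
    have hU0 : 0 ≤ iU y * (p x * q y) := mul_nonneg (hiU0 y) h0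
    by_cases hx : logW p q x < c
    · have h1 : iL x = 1 := by simp only [hiL]; rw [if_pos hx]
      rw [h1, one_mul]
      linarith [min_le_left (p x * q y) (p y * q x)]
    · by_cases hy : c - a < logW p q y
      · have h1 : iU y = 1 := by simp only [hiU]; rw [if_pos hy]
        rw [h1, one_mul]
        linarith [min_le_left (p x * q y) (p y * q x)]
      · have hdiff : logW p q y - logW p q x ≤ -a := by
          have hx' := not_lt.mp hx
          have hy' := not_lt.mp hy
          linarith
        have hexp : Real.exp (logW p q y - logW p q x) ≤ Real.exp (-a) :=
          Real.exp_le_exp.mpr hdiff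
        calc min (p x * q y) (p y * q x) ≤ p y * q x := min_le_right _ _
          _ = p x * q y * Real.exp (logW p q y - logW p q x) := hswap x y
          _ ≤ p x * q y * Real.exp (-a) := mul_le_mul_of_nonneg_left hexp h0
          _ = Real.exp (-a) * (p x * q y) := mul_comm _ _
          _ ≤ _ := by linarith
  have hsum : accRate p q ≤ ∑ x, ∑ y,
      (Real.exp (-a) * (p x * q y) + iL x * (p x * q y) + iU y * (p x * q y)) :=
    sum_le_sum fun x _ => sum_le_sum fun y _ => hpt x y
  have hval : ∑ x, ∑ y,
      (Real.exp (-a) * (p x * q y) + iL x * (p x * q y) + iU y * (p x * q y))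
      = Real.exp (-a) + ∑ x, iL x * p x + ∑ y, iU y * q y := by
    have h1 : ∀ x, ∑ y,
        (Real.exp (-a) * (p x * q y) + iL x * (p x * q y) + iU y * (p x * q y))
        = Real.exp (-a) * p x + iL x * p x + p x * ∑ y, iU y * q y := by
      intro x
      rw [sum_add_distrib, sum_add_distrib]
      have e1 : ∑ y, Real.exp (-a) * (p x * q y) = Real.exp (-a) * p x := by
        rw [← mul_sum, ← mul_sum, hq1, mul_one]
      have e2 : ∑ y, iL x * (p x * q y) = iL x * p x := by
        rw [← mul_sum, ← mul_sum, hq1, mul_one]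
      have e3 : ∑ y, iU y * (p x * q y) = p x * ∑ y, iU y * q y := by
        rw [mul_sum]; exact sum_congr rfl fun y _ => by ring
      rw [e1, e2, e3]
    simp_rw [h1]
    rw [sum_add_distrib, sum_add_distrib, ← mul_sum, hp1, mul_one, ← sum_mul, hp1, one_mul]
  have hL : ∑ x, iL x * p x = ∑ x ∈ univ.filter (fun x => logW p q x < c), p x := by
    rw [sum_filter]
    exact sum_congr rfl fun x _ => by simp only [hiL]; split_ifs <;> simp
  have hU : ∑ y, iU y * q y = ∑ y ∈ univ.filter (fun y => c - a < logW p q y), q y := by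
    rw [sum_filter]
    exact sum_congr rfl fun y _ => by simp only [hiU]; split_ifs <;> simp
  rw [hval, hL, hU] at hsum
  exact hsum

/-- **T2-AB′ (acceptance vs Jeffreys divergence and log-weight variances; proved).**
For any `0 < J ≤ D(p‖q) + D(q‖p)`:  `acc(p, q) ≤ e^{−J/2} + 16·(Var_p ℓ + Var_q ℓ)/J²`
(take `c = D(p‖q) − J/4`, `a = J/2` in T2-AB and Chebyshev on both tails).  Consequence: if
the Jeffreys divergence grows linearly in the number of blocks (`≥ 2mδ²`, T2-I) while both
log-weight variances grow at most linearly, the acceptance tends to ZERO; at fixed acceptance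
`α` the per-block defect must therefore shrink (`mδ⁴ ≤ 8(Var_p ℓ + Var_q ℓ)/(m(α − e^{−mδ²}))`).
[folklore] -/
theorem accRate_le_of_jeffreys {p q : X → ℝ} (hp : ∀ x, 0 < p x) (hq : ∀ x, 0 < q x)
    (hp1 : ∑ x, p x = 1) (hq1 : ∑ x, q x = 1) {J : ℝ} (hJ0 : 0 < J)
    (hJ : J ≤ klFin p q + klFin q p) :
    accRate p q ≤ Real.exp (-(J / 2)) +
      16 * (varLaw p (logW p q) + varLaw q (logW p q)) / J ^ 2 := by
  have h := accRate_le_tails hp hq hp1 hq1 (J / 2) (klFin p q - J / 4)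
  have hs : (0:ℝ) < J / 4 := by positivity
  have hL : ∑ x ∈ univ.filter (fun x => logW p q x < klFin p q - J / 4), p x ≤
      varLaw p (logW p q) / (J / 4) ^ 2 := by
    refine chebyshev_set (fun x => (hp x).le) hp1 (logW p q) hs _ fun x hx => ?_
    have hx' := (mem_filter.mp hx).2
    have hmean : ∑ y, p y * logW p q y = klFin p q := rfl
    rw [hmean]
    exact le_abs.mpr (Or.inr (by linarith))
  have hU : ∑ y ∈ univ.filter (fun y => klFin p q - J / 4 - J / 2 < logW p q y), q y ≤
      varLaw q (logW p q) / (J / 4) ^ 2 := by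
    refine chebyshev_set (fun x => (hq x).le) hq1 (logW p q) hs _ fun y hy => ?_
    have hy' := (mem_filter.mp hy).2
    rw [sum_mul_logW_eq_neg_klFin p q]
    exact le_abs.mpr (Or.inl (by linarith))
  have e : varLaw p (logW p q) / (J / 4) ^ 2 + varLaw q (logW p q) / (J / 4) ^ 2 =
      16 * (varLaw p (logW p q) + varLaw q (logW p q)) / J ^ 2 := by
    have hJne : J ≠ 0 := hJ0.ne'
    field_simp
    ring
  linarith [h, hL, hU, e]

/-- **T2-AB″ (acceptance volume law under a variance budget; proved).**  If
`D(p‖q) ≥ 2mδ²` (e.g. `m` model-independent blocks with defect `≥ δ`, T2-I) and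
`Var_p ℓ + Var_q ℓ ≤ B`, then `acc ≤ e^{−mδ²} + 4B/(m²δ⁴)`. -/
theorem accRate_blocks_le {p q : X → ℝ} (hp : ∀ x, 0 < p x) (hq : ∀ x, 0 < q x)
    (hp1 : ∑ x, p x = 1) (hq1 : ∑ x, q x = 1) {m δ B : ℝ} (hm : 0 < m) (hδ : 0 < δ)
    (hD : m * (2 * δ ^ 2) ≤ klFin p q) (hB : varLaw p (logW p q) + varLaw q (logW p q) ≤ B) :
    accRate p q ≤ Real.exp (-(m * δ ^ 2)) + 4 * B / (m ^ 2 * δ ^ 4) := by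
  have hJ0 : 0 < m * (2 * δ ^ 2) := by positivity
  have hqp : 0 ≤ klFin q p := klFin_nonneg (fun x => (hq x).le) hp (by rw [hq1, hp1])
  have h := accRate_le_of_jeffreys hp hq hp1 hq1 hJ0 (by linarith)
  have e1 : Real.exp (-(m * (2 * δ ^ 2) / 2)) = Real.exp (-(m * δ ^ 2)) := by
    congr 1; ring
  have e2 : 16 * (varLaw p (logW p q) + varLaw q (logW p q)) / (m * (2 * δ ^ 2)) ^ 2
      ≤ 4 * B / (m ^ 2 * δ ^ 4) := by
    rw [show (m * (2 * δ ^ 2)) ^ 2 = 4 * (m ^ 2 * δ ^ 4) by ring, show (16 : ℝ) = 4 * 4 by norm_num,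
      mul_assoc, mul_div_mul_left _ _ (by norm_num : (4:ℝ) ≠ 0)]
    exact div_le_div_of_nonneg_right (by linarith) (by positivity)
  rw [e1] at h
  linarith

end AccTails

/-! ### L-9: the model's sector histogram caps the acceptance -/

section AccSector

variable {Y : Type*} [Fintype Y] [DecidableEq Y]

/-- **L-9 (proved).**  `acc(p, q) ≤ 1 − ‖π_* p − π_* q‖_TV` for every coarse-graining `π`:
a model whose topological-charge histogram is off by `ε` in total variation has acceptance
`≤ 1 − ε`, whatever it does inside the sectors (L-7 + T2-E). -/
theorem accRate_le_one_sub_tvDist_coarse (π : X → Y) {p q : X → ℝ} (hp1 : ∑ x, p x = 1)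
    (hq1 : ∑ x, q x = 1) : accRate p q ≤ 1 - tvDist (coarse π p) (coarse π q) :=
  (accRate_le_accRate_coarse π p q).trans
    (accRate_le (by rw [sum_coarse, hp1]) (by rw [sum_coarse, hq1]))

end AccSector

end Summit.Ventures.LatticeQCDFlow.Theory2
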